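import Literature.AlgebraicGeometry.Motives.AlbaneseExistenceComplex
import Literature.AlgebraicGeometry.Motives.GeneratesBaseChange
import Literature.AlgebraicGeometry.Motives.JacobianGaloisDescentOfUniversal
import Literature.AlgebraicGeometry.Motives.BaseChangeProofs
import HarnessLib

/-!
# The Albanese variety of a pointed smooth projective variety over a subfield of `ℂ`

Topic `Literature/AlgebraicGeometry/Motives`, sequel of `AlbaneseExistenceComplex` (existence of the
Albanese datum `Motives.Jacobian X` of every smooth projective COMPLEX variety, any dimension) and
`GeneratesBaseChange` (`Generates φ → Generates φ_L`).  DISTINCT from the neighbour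
`AlbaneseExistenceComplex`: there the base field IS `ℂ`; here it is an arbitrary SUBFIELD `k ⊆ ℂ`
(`[Algebra k ℂ]`), and the Albanese datum is produced OVER `k` (the complex bound is transported by base
change, the point-free case by Galois descent). PROOF FILE: theorems only — no definition, no
named fact, sorry-free (D-0026).

* `Generates.two_mul_dim_le_finrank_complexBetti_baseChange` — **Serre's bound over `k ⊆ ℂ`**: if
  `φ : X → A` generates `A`, `X / k` smooth projective, then `2 dim A ≤ b₁(X(ℂ))`
  (`Generates.baseChange`, `AbelianVariety.dim_baseChange`, and the complex bound
  `Generates.two_mul_dim_le_finrank_complexBetti`: Voisin I Lemma 7.28, Lang II §3 Thm. 11).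
* **`nonempty_jacobian_of_isSmoothProjective_of_algPoints_of_algebra_complex`** — EXISTENCE OF THE
  ALBANESE VARIETY OVER `k ⊆ ℂ`, POINTED CASE: every smooth projective geometrically irreducible
  `X / k` of any dimension with a rational point has a `Jacobian X` over `k` (Serre, exp. 10, no. 2
  Thm. 2 + Corollaire — the tree's PROVED criterion `exists_universal_of_dim_le` — fed with the bound
  above; then Milne Prop. 6.4 from 6.1, `Jacobian.ofPointed`). The case `k = ℂ` (where a point always
  exists) is `nonempty_jacobian_of_isSmoothProjective_complex_of_dim`.
* `Jacobian.two_mul_dim_le_finrank_complexBetti_baseChange` — `2 dim J ≤ b₁(X(ℂ))` for every Albanese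
  datum of such an `X`.
* **`nonempty_jacobian_of_isSmoothProjective_of_algebra_complex`** — THE POINT-FREE CASE: every smooth
  projective geometrically irreducible `X / k`, `k ⊆ ℂ`, of any dimension, has a `Jacobian X` over `k`
  (a point over a finite Galois `L / k`, `IsSmoothProjective.exists_algPoints`; an embedding `L → ℂ`
  over `k`, Mathlib `IsAlgClosed.lift`; the pointed case over `L`; Galois descent of the abstract
  Albanese datum, `Jacobian.nonempty_of_jacobian_baseChange` of `JacobianGaloisDescentOfUniversal`).

What this does NOT give (residuals, unchanged): fields not embeddable in `ℂ` or of positive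
characteristic (the named fact `nonempty_jacobian_of_algPoints` in that generality), geometrically
reducible or non-proper `X`, and the equality `2 dim Alb(X) = b₁(X)`.
Relies on: nothing unproved (axioms `propext`, `Classical.choice`, `Quot.sound`).

## References

* [Serre1958MorphismesUniversels] J.-P. Serre, *Morphismes universels et variété d'Albanese*, Sém.
  Chevalley 4 (1958/59), exp. 10: no. 2 Thm. 2 and Corollaire.
* [Lang1983AbelianVarieties] S. Lang, *Abelian Varieties* (1959/1983), II §3, Thm. 11.
* [Badescu2001] L. Bădescu, *Algebraic Surfaces* (2001), Ch. 5 Def. 5.2, Thm. 5.3.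
* [Milne1986JacobianVarieties] J. S. Milne, *Jacobian Varieties* (1986), §6 Prop. 6.1, 6.4, Remark 6.5.
* [Voisin2002] C. Voisin, *Hodge Theory and Complex Algebraic Geometry I* (2002), Lemma 7.28.
-/

noncomputable section

universe u

open CategoryTheory CategoryTheory.Limits AlgebraicGeometry MonoidalCategory CartesianMonoidalCategory

namespace Literature.AlgebraicGeometry.Motives

open scoped MonObj
open AbelianVariety (bcSpec bcFunctor)

/-! ### Existence of the Albanese variety of a pointed smooth projective variety over a subfield of `ℂ` -/

section Existence

open Literature.AlgebraicGeometry.HodgeTheory Literature.AlgebraicTopology.SingularHomology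

variable {k : Type} [Field k] [Algebra k ℂ] {d : ℕ} {X : SchemeOver k}

/-- **Serre's dimension bound over a subfield of `ℂ`**: if `φ : X → A` generates the abelian
variety `A`, `X` smooth projective of dimension `d` over a field `k ⊆ ℂ`, then
`2 dim A ≤ b₁(X(ℂ))` — base change to `ℂ` (`Generates.baseChange`, `dim A_ℂ = dim A`) and the
complex bound `Generates.two_mul_dim_le_finrank_complexBetti` (Voisin I Lemma 7.28; Lang II §3
Thm. 11; Serre no. 2 Corollaire). [cite: Lang1983AbelianVarieties, II §3 Thm. 11]
[cite: Serre1958MorphismesUniversels, no. 2 Thm. 2 and Corollaire] -/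
theorem Generates.two_mul_dim_le_finrank_complexBetti_baseChange (hX : IsSmoothProjective d X)
    {A : AbelianVariety k} {φ : X ⟶ A.X} (hφ : Generates φ) :
    2 * A.dim ≤ Module.finrank ℂ (complexBetti ((bcFunctor k ℂ).obj X) 1) := by
  have hXL : IsSmoothProjective d ((bcFunctor k ℂ).obj X) := hX.baseChange_obj ℂ
  have h := (hφ.baseChange ℂ).two_mul_dim_le_finrank_complexBetti hXL
  rwa [AbelianVariety.dim_baseChange] at h

/-- A rational point in its two guises: `P : Spec k → X` kills `g` iff `P.toUnitHom : 𝟙_ → X` does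
(glue between `AlgPoints` and the monoidal unit; twin of the private lemma of
`Motives/AlbaneseExistenceComplex`). [folklore] -/
private theorem AlgPoints.comp_eq_one_iff_toUnitHom_comp_eq_one' {K' : Type u} [Field K']
    {Y : SchemeOver K'} (P : AlgPoints Y K') {A : AbelianVariety K'} (g : Y ⟶ A.X) :
    P ≫ g = 1 ↔ P.toUnitHom ≫ g = 1 := by
  constructor
  · intro h
    rw [AlgPoints.toUnitHom, Category.assoc, h]
    exact MonObj.comp_one _
  · intro h
    have e : P = toUnit _ ≫ P.toUnitHom := by
      rw [AlgPoints.toUnit_comp_toUnitHom, ← eq_toSpecOver (𝟙 _), Category.id_comp]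
    rw [e, Category.assoc, h]
    exact MonObj.comp_one _

variable (X) in
/-- **Existence of the Albanese variety over a subfield of `ℂ` (pointed case)** (Serre,
*Morphismes universels et variété d'Albanese*, no. 2 Thm. 2 with Corollaire and no. 4 Thm. 6;
Lang, *Abelian Varieties*, II §3 Thm. 11; Bădescu, *Algebraic Surfaces*, Def. 5.2 / Thm. 5.3), in
the tree's point-free form `Motives.Jacobian X` (Milne, *Jacobian Varieties*, Prop. 6.4 from
Prop. 6.1): every smooth projective geometrically irreducible variety `X` of any dimension `d` over
a field `k ⊆ ℂ`, WITH A RATIONAL POINT `P ∈ X(k)`, has an Albanese datum OVER `k` — an abelian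
variety `J / k` with a difference map `X × X → J` universal among morphisms to abelian varieties
trivial on the diagonal. Proof: Serre's universal-morphism criterion (the tree's PROVED
`exists_universal_of_dim_le`: a universal pointed morphism `(X, P) → (J, 0)` exists as soon as the
abelian varieties generated by pointed morphisms `X → A` have bounded dimension) with the bound
`dim A ≤ b₁(X(ℂ))` of `Generates.two_mul_dim_le_finrank_complexBetti_baseChange`, then
`Jacobian.ofPointed`. The case `k = ℂ` is `nonempty_jacobian_of_isSmoothProjective_complex_of_dim`.
[cite: Serre1958MorphismesUniversels, no. 2 Thm. 2 and Corollaire] [cite: Lang1983AbelianVarieties, II §3 Thm. 11]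
[cite: Badescu2001, Ch. 5 Def. 5.2 and Thm. 5.3] [cite: Milne1986JacobianVarieties, §6 Prop. 6.1, Prop. 6.4 and Remark 6.5] -/
theorem nonempty_jacobian_of_isSmoothProjective_of_algPoints_of_algebra_complex
    (hX : IsSmoothProjective d X) (P : AlgPoints X k) : Nonempty (Jacobian X) := by
  classical
  haveI := IsSmoothProjective.isProper_holds hX
  haveI := IsSmoothProjective.geometricallyIntegral_holds hX
  have hP := fun {A : AbelianVariety k} (g : X ⟶ A.X) =>
    P.comp_eq_one_iff_toUnitHom_comp_eq_one' g
  obtain ⟨J, f, hf, hgen, huniv⟩ := exists_universal_of_dim_le P.toUnitHom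
    (Module.finrank ℂ (complexBetti ((bcFunctor k ℂ).obj X) 1)) (fun A g _ hg => by
      have h := hg.two_mul_dim_le_finrank_complexBetti_baseChange hX
      omega)
  refine ⟨Jacobian.ofPointed P J f ((hP f).2 hf)
    (fun g hg => (huniv _ g ((hP g).1 hg)).choose)
    (fun g hg => (huniv _ g ((hP g).1 hg)).choose_spec)
    (fun g hg ψ hψ => ?_)⟩
  exact hgen.hom_ext (hψ.trans (huniv _ g ((hP g).1 hg)).choose_spec.symm)

/-- **Every Albanese map generates, with Serre's bound, over a subfield of `ℂ`**: for any Albanese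
datum `𝒥 : Jacobian X` of a smooth projective `X / k`, `k ⊆ ℂ`, with a rational point,
`2 dim J ≤ b₁(X(ℂ))` (`Jacobian.generates_abelJacobi` and the bound above).
[cite: Lang1983AbelianVarieties, II §3 Thm. 11] -/
theorem Jacobian.two_mul_dim_le_finrank_complexBetti_baseChange (hX : IsSmoothProjective d X)
    (𝒥 : Jacobian X) (P : AlgPoints X k) :
    2 * 𝒥.J.dim ≤ Module.finrank ℂ (complexBetti ((bcFunctor k ℂ).obj X) 1) := by
  haveI := IsSmoothProjective.isProper_holds hX
  haveI := IsSmoothProjective.geometricallyIntegral_holds hX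
  exact (𝒥.generates_abelJacobi P).two_mul_dim_le_finrank_complexBetti_baseChange hX

/-- **Existence of the Albanese variety over a subfield of `ℂ`** (Serre, exp. 10, Thm. 2 with
Corollaire and no. 4; Lang, *Abelian Varieties*, II §3 Thm. 11; Bădescu Thm. 5.3; in Milne's
point-free form `Motives.Jacobian X`, *Jacobian Varieties* Prop. 6.4 / Remark 6.5): every smooth
projective geometrically irreducible variety `X`, of any dimension, over a field `k ⊆ ℂ` has an
Albanese datum over `k`. Proof: `X` has a point over a finite Galois `L / k`
(`IsSmoothProjective.exists_algPoints`); `L` embeds into `ℂ` over `k` (Mathlib `IsAlgClosed.lift`);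
the pointed case over `L` (`nonempty_jacobian_of_isSmoothProjective_of_algPoints_of_algebra_complex`)
gives a Jacobian of `X_L`, which descends to `k` (`Jacobian.nonempty_of_jacobian_baseChange`).
[cite: Serre1958MorphismesUniversels, no. 2 Thm. 2 and Corollaire] [cite: Lang1983AbelianVarieties, II §3 Thm. 11]
[cite: Milne1986JacobianVarieties, §6 Prop. 6.4 (proof) and Remark 6.5] -/
theorem nonempty_jacobian_of_isSmoothProjective_of_algebra_complex (hX : IsSmoothProjective d X) :
    Nonempty (Jacobian X) := by
  obtain ⟨L, _, _, _, _, ⟨P⟩⟩ := hX.exists_algPoints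
  letI : Algebra L ℂ := (IsAlgClosed.lift : L →ₐ[k] ℂ).toRingHom.toAlgebra
  have hXL : IsSmoothProjective d ((bcFunctor k L).obj X) := hX.baseChange_obj L
  obtain ⟨𝒥⟩ := nonempty_jacobian_of_isSmoothProjective_of_algPoints_of_algebra_complex _ hXL
    (Jacobian.pointBaseChange L P)
  exact Jacobian.nonempty_of_jacobian_baseChange hX L 𝒥

end Existence

end Literature.AlgebraicGeometry.Motives

end
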